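import Literature.Algebra.Homology.ContCohomologyTransgression
import HarnessLib

/-!
# The kernel of the transgression of a topological central extension

Companion of `ContCohomologyCentralExtension.lean` / `ContCohomologyTransgression.lean` (same setting:
a central extension `1 → A → Ẽ →q→ B → 1` of topological groups, a continuous homomorphism `φ : G → B`,
a continuous LIFT `t : G → Ẽ` of `φ`, a topological abelian group `Λ` with the trivial action, and the
transgression `transgression q φ t ht hA : Hom_cont(A, Λ) → H²(G, Λ)`, `χ ↦ [χ ∘ c_t]`).

This proof-only file (no definitions) identifies the KERNEL of the transgression — the exactness of
the five-term sequence of the extension at `Hom(A, Λ) = H⁰(B, H¹(A, Λ))`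
[cite: SerreGaloisCohomology1997, I §2.6 (b)] — for Mathlib's `continuousCohomology` (homology of the
homogeneous continuous cochains in `TopModuleCat`):

* `exists_toCycles_eq_of_π_two_eq_zero` — a `2`-cocycle with vanishing class is the coboundary of a
  `1`-cochain (the homology of `TopModuleCat` is the CONCRETE cokernel `TopModuleCat.isColimitCoker`;
  degree-`2` twin of `ContCohomologyCrossedHomPrincipal.exists_toCycles_eq_of_π_eq_zero`);
* `exists_eq_of_transgression_eq_zero` — if `transgression χ = 0` then the pushed factor set is an
  (inhomogeneous) coboundary: `χ(c_t(g, h)) = b(g) + b(h) − b(g h)` for a continuous `b : G → Λ`;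
* `transgression_eq_zero_of_eq` — conversely such a `b` forces `transgression χ = 0`;
* the SECTION case `φ = id`, `t` a continuous section of `q`:
  `exists_extension_of_transgression_eq_zero` / `transgression_eq_zero_of_extension` /
  `transgression_eq_zero_iff_exists_extension` — `transgression χ = 0` iff `χ` is the restriction to
  `A` of a continuous homomorphism `ψ : Ẽ → Λ` (`ψ(a · t(g)) := χ(a) + b(g)`);
* `transgression_injective_iff` — the transgression is INJECTIVE iff every continuous homomorphism
  `Ẽ → Λ` kills `A`; `transgression_injective_of_extKer_le` — in particular if `A` lies in the
  closure of the commutator subgroup of `Ẽ` and `Λ` is `T₁`.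

Generic; no anabelian content.  (Written for [AbsTopIII] Prop. 1.4 (ii): the injectivity half of
"the differential `Hom(M_X, I_x) → H²(Δ_X, ·)` is an isomorphism" holds as soon as `I_x` lies in the
closed commutator subgroup of `Δ_{U_x}` — see `AbsTopIII/CcnTransgressionInjective.lean`.)
-/

noncomputable section

open CategoryTheory CategoryTheory.Limits TopRep ContRepresentation Topology

namespace ContinuousCohomology

universe u v w

/-! ### Classes in `H²` that vanish come from `1`-cochains -/

section CyclesTwo

variable {k : Type u} [Ring k] [TopologicalSpace k]
variable {G : Type v} [Group G] [TopologicalSpace G] [IsTopologicalGroup G]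
variable (X : TopRep.{max v w} k G)

/-- A `2`-cocycle of the homogeneous cochain complex whose cohomology class vanishes is the image of a
`1`-cochain under `toCycles : C¹ → Z²` (a coboundary): `H² = (homogeneousCochains X).homology 2` is a
cokernel of `toCycles` (`homologyIsCokernel`), and in `TopModuleCat k` that cokernel is, up to the
canonical comparison, the module quotient `Z² ⧸ range (toCycles)` (`TopModuleCat.isColimitCoker`).
[cite: SerreGaloisCohomology1997, I §2.3] -/
theorem exists_toCycles_eq_of_π_two_eq_zero (z : (homogeneousCochains X).cycles 2)
    (hz : ((homogeneousCochains X).homologyπ 2).hom z = 0) :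
    ∃ σ : (homogeneousCochains X).X 1, ((homogeneousCochains X).toCycles 1 2).hom σ = z := by
  have hc := (homogeneousCochains X).homologyIsCokernel 1 2 (by simp)
  have hc' := TopModuleCat.isColimitCoker ((homogeneousCochains X).toCycles 1 2)
  have hcomm := IsColimit.comp_coconePointUniqueUpToIso_hom hc hc' WalkingParallelPair.one
  rw [Cofork.app_one_eq_π, Cofork.app_one_eq_π, Cofork.π_ofπ, Cofork.π_ofπ] at hcomm
  have hcomm' : (homogeneousCochains X).homologyπ 2 ≫ (hc.coconePointUniqueUpToIso hc').hom =
      TopModuleCat.cokerπ ((homogeneousCochains X).toCycles 1 2) := hcomm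
  have h2 := congrArg (fun ψ => TopModuleCat.Hom.hom ψ z) hcomm'
  change (hc.coconePointUniqueUpToIso hc').hom.hom (((homogeneousCochains X).homologyπ 2).hom z) =
    (TopModuleCat.cokerπ ((homogeneousCochains X).toCycles 1 2)).hom z at h2
  rw [hz] at h2
  have h3 : (TopModuleCat.cokerπ ((homogeneousCochains X).toCycles 1 2)).hom z = 0 := by
    rw [← h2]
    exact map_zero _
  exact (Submodule.Quotient.mk_eq_zero _).mp h3

end CyclesTwo

/-! ### The kernel of the transgression -/

section Transgression

variable {E B : Type v} [Group E] [TopologicalSpace E] [IsTopologicalGroup E]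
  [Group B] [TopologicalSpace B] [IsTopologicalGroup B] (q : E →ₜ* B)
  {G : Type v} [Group G] [TopologicalSpace G] [IsTopologicalGroup G]
  (φ : G →ₜ* B) (t : C(G, E)) (ht : ∀ g, q (t g) = φ g)
  {Λ : Type v} [AddCommGroup Λ] [TopologicalSpace Λ] [IsTopologicalAddGroup Λ]

/-- The coboundary of a homogeneous `1`-cochain of the trivial module, evaluated:
`(d¹ σ)(x)(y)(z) = σ(y, z) − (σ(x, z) − σ(x, y))`. [cite: SerreGaloisCohomology1997, I §2.3] -/
theorem d_oneCochain_apply (σ : (homogeneousCochains (trivCoeff G Λ)).X 1) (x y z : G) :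
    (((homogeneousCochains (trivCoeff G Λ)).d 1 2).hom σ).1 x y z =
      σ.1 y z - (σ.1 x z - σ.1 x y) := by
  have h := homogeneousCochains.d_apply (trivCoeff G Λ) 1 σ
  rw [h]
  rfl

/-- An invariant homogeneous `1`-cochain of the trivial module is determined by its values at
`(1, ·)`: `σ(x, y) = σ(1, x⁻¹ y)`. [cite: SerreGaloisCohomology1997, I §2.3] -/
theorem oneCochain_apply_eq (σ : (homogeneousCochains (trivCoeff G Λ)).X 1) (x y : G) :
    σ.1 x y = σ.1 1 (x⁻¹ * y) := by
  have h := congrArg (fun c : C(G, C(G, Λ)) => c 1 (x⁻¹ * y)) (σ.2 x⁻¹)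
  change σ.1 (x⁻¹⁻¹ * 1) (x⁻¹⁻¹ * (x⁻¹ * y)) = σ.1 1 (x⁻¹ * y) at h
  rw [inv_inv, mul_one, mul_inv_cancel_left] at h
  exact h

omit [IsTopologicalGroup B] in
/-- **Hard direction.** If `transgression χ = 0`, then the pushed factor set is an inhomogeneous
coboundary: there is a continuous `b : G → Λ` with `χ(c_t(g, h)) = b(g) + b(h) − b(g h)` for all
`g, h` (namely `b(g) = σ(1, g)` for a bounding homogeneous `1`-cochain `σ`).
[cite: SerreGaloisCohomology1997, I §2.6 (b)] -/
theorem exists_eq_of_transgression_eq_zero (hA : ∀ a ∈ extKer q, ∀ e : E, e * a = a * e)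
    (χ : Additive (extKer q) →ₜ+ Λ) (h0 : transgression q φ t ht hA χ = 0) :
    ∃ b : C(G, Λ), ∀ g h,
      χ (Additive.ofMul (factorSet q φ t ht g h)) = b g + b h - b (g * h) := by
  rw [transgression_apply] at h0
  obtain ⟨σ, hσ⟩ := exists_toCycles_eq_of_π_two_eq_zero.{0, v, v} (trivCoeff G Λ) _ h0
  -- the cochain of `d¹ σ` is the pushed cochain of `χ`
  have hd : ((homogeneousCochains (trivCoeff G Λ)).d 1 2).hom σ = pushTwoCochain q φ t ht χ := by
    have h := congrArg (fun ψ => ψ.hom σ) ((homogeneousCochains (trivCoeff G Λ)).toCycles_i 1 2)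
    simp only [TopModuleCat.hom_comp, ContinuousLinearMap.coe_comp, Function.comp_apply] at h
    rw [hσ, iCycles_cocycleMkTwo] at h
    exact h.symm
  have hev : ∀ x y z : G, σ.1 y z - (σ.1 x z - σ.1 x y) =
      χ (Additive.ofMul (factorSet q φ t ht (x⁻¹ * y) (y⁻¹ * z))) := by
    intro x y z
    rw [← d_oneCochain_apply, hd]
    rfl
  refine ⟨σ.1 1, fun g h => ?_⟩
  have key := hev 1 g (g * h)
  rw [inv_one, one_mul, inv_mul_cancel_left, oneCochain_apply_eq (Λ := Λ) σ g (g * h),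
    inv_mul_cancel_left] at key
  rw [← key]
  abel

omit [IsTopologicalGroup B] in
/-- **Easy direction.** If the pushed factor set is an inhomogeneous coboundary of a continuous
`b : G → Λ`, then `transgression χ = 0`: the pushed homogeneous `2`-cochain is `d¹` of the invariant
`1`-cochain `(x, y) ↦ b(x⁻¹ y)`. [cite: SerreGaloisCohomology1997, I §2.6 (b)] -/
theorem transgression_eq_zero_of_eq (hA : ∀ a ∈ extKer q, ∀ e : E, e * a = a * e)
    (χ : Additive (extKer q) →ₜ+ Λ) (b : C(G, Λ))
    (hb : ∀ g h, χ (Additive.ofMul (factorSet q φ t ht g h)) = b g + b h - b (g * h)) :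
    transgression q φ t ht hA χ = 0 := by
  -- the bounding invariant `1`-cochain `σ(x, y) = b(x⁻¹ y)`
  let F : C(G × G, Λ) := ⟨fun p => b (p.1⁻¹ * p.2), b.continuous.comp (continuous_fst.inv.mul continuous_snd)⟩
  let σ : (homogeneousCochains (trivCoeff G Λ)).X 1 :=
    ⟨F.curry, fun g => by
      refine ContinuousMap.ext fun x => ContinuousMap.ext fun y => ?_
      change b ((g⁻¹ * x)⁻¹ * (g⁻¹ * y)) = b (x⁻¹ * y)
      rw [mul_inv_rev, inv_inv, mul_assoc, mul_inv_cancel_left]⟩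
  have hd : ((homogeneousCochains (trivCoeff G Λ)).d 1 2).hom σ = pushTwoCochain q φ t ht χ := by
    apply Subtype.ext
    ext x y z
    rw [d_oneCochain_apply]
    change b (y⁻¹ * z) - (b (x⁻¹ * z) - b (x⁻¹ * y)) =
      χ (Additive.ofMul (factorSet q φ t ht (x⁻¹ * y) (y⁻¹ * z)))
    have e1 : x⁻¹ * y * (y⁻¹ * z) = x⁻¹ * z := by rw [mul_assoc, mul_inv_cancel_left]
    rw [hb, e1]
    abel
  rw [transgression_apply]
  have hz : cocycleMkTwo (trivCoeff G Λ) (pushTwoCochain q φ t ht χ)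
      (d_pushTwoCochain q φ t ht hA χ) =
      ((homogeneousCochains (trivCoeff G Λ)).toCycles 1 2).hom σ := by
    apply cocyclesTwo_ext (trivCoeff G Λ)
    rw [iCycles_cocycleMkTwo]
    have h := congrArg (fun ψ => ψ.hom σ) ((homogeneousCochains (trivCoeff G Λ)).toCycles_i 1 2)
    simp only [TopModuleCat.hom_comp, ContinuousLinearMap.coe_comp, Function.comp_apply] at h
    rw [h, hd]
  rw [hz]
  have h := congrArg (fun ψ => ψ.hom σ)
    ((homogeneousCochains (trivCoeff G Λ)).toCycles_comp_homologyπ 1 2)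
  simp only [TopModuleCat.hom_comp, ContinuousLinearMap.coe_comp, Function.comp_apply] at h
  exact h

omit [IsTopologicalGroup B] in
/-- **`transgression χ = 0` iff the pushed factor set `χ ∘ c_t` is the inhomogeneous coboundary of a
continuous function `G → Λ`.** [cite: SerreGaloisCohomology1997, I §2.6 (b)] -/
theorem transgression_eq_zero_iff_exists (hA : ∀ a ∈ extKer q, ∀ e : E, e * a = a * e)
    (χ : Additive (extKer q) →ₜ+ Λ) :
    transgression q φ t ht hA χ = 0 ↔
      ∃ b : C(G, Λ), ∀ g h, χ (Additive.ofMul (factorSet q φ t ht g h)) = b g + b h - b (g * h) :=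
  ⟨exists_eq_of_transgression_eq_zero q φ t ht hA χ,
    fun ⟨b, hb⟩ => transgression_eq_zero_of_eq q φ t ht hA χ b hb⟩

end Transgression

/-! ### The section case: `ker(transgression) = res (Hom_cont(Ẽ, Λ))` -/

section Section

variable {E B : Type v} [Group E] [TopologicalSpace E] [IsTopologicalGroup E]
  [Group B] [TopologicalSpace B] [IsTopologicalGroup B] (q : E →ₜ* B)
  (s : C(B, E)) (hs : ∀ b, q (s b) = ContinuousMonoidHom.id B b)
  {Λ : Type v} [AddCommGroup Λ] [TopologicalSpace Λ] [IsTopologicalAddGroup Λ]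

omit [IsTopologicalGroup E] [IsTopologicalGroup B] in
include hs in
/-- For a section `s` of `q`, `e · s(q e)⁻¹ ∈ A = Ker q`. [cite: SerreGaloisCohomology1997, I §2.3] -/
theorem mul_section_inv_mem_extKer (e : E) : e * (s (q e))⁻¹ ∈ extKer q := by
  rw [MonoidHom.mem_ker]
  change q (e * (s (q e))⁻¹) = 1
  rw [map_mul, map_inv, hs]
  change q e * (q e)⁻¹ = 1
  exact mul_inv_cancel _

/-- **If `χ` is the restriction of a continuous homomorphism `ψ : Ẽ → Λ`, then
`transgression χ = 0`** (with `b := ψ ∘ s`, `χ(c_s(g, h)) = ψ(s g) + ψ(s h) − ψ(s(gh))`).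
[cite: SerreGaloisCohomology1997, I §2.6 (b)] -/
theorem transgression_eq_zero_of_extension (hA : ∀ a ∈ extKer q, ∀ e : E, e * a = a * e)
    (χ : Additive (extKer q) →ₜ+ Λ) (ψ : Additive E →ₜ+ Λ)
    (hψ : ∀ a : extKer q, ψ (Additive.ofMul (a : E)) = χ (Additive.ofMul a)) :
    transgression q (ContinuousMonoidHom.id B) s hs hA χ = 0 := by
  refine transgression_eq_zero_of_eq q (ContinuousMonoidHom.id B) s hs hA χ
    ⟨fun g => ψ (Additive.ofMul (s g)), ψ.continuous.comp (continuous_ofMul.comp s.continuous)⟩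
    fun g h => ?_
  rw [← hψ, coe_factorSet]
  change ψ (Additive.ofMul (s g * s h * (s (g * h))⁻¹)) =
    ψ (Additive.ofMul (s g)) + ψ (Additive.ofMul (s h)) - ψ (Additive.ofMul (s (g * h)))
  rw [ofMul_mul, ofMul_mul, ofMul_inv, map_add, map_add, map_neg, sub_eq_add_neg]

/-- **If `transgression χ = 0`, then `χ` EXTENDS to a continuous homomorphism `ψ : Ẽ → Λ`**:
with `b` from `exists_eq_of_transgression_eq_zero`, `ψ(e) := χ(e · s(q e)⁻¹) + b(q e)` is additive
because `A` is central and `e₁ e₂ · s(q(e₁ e₂))⁻¹ = (e₁ s(q e₁)⁻¹)(e₂ s(q e₂)⁻¹) c_s(q e₁, q e₂)`.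
[cite: SerreGaloisCohomology1997, I §2.6 (b)] -/
theorem exists_extension_of_transgression_eq_zero (hA : ∀ a ∈ extKer q, ∀ e : E, e * a = a * e)
    (χ : Additive (extKer q) →ₜ+ Λ) (h0 : transgression q (ContinuousMonoidHom.id B) s hs hA χ = 0) :
    ∃ ψ : Additive E →ₜ+ Λ, ∀ a : extKer q, ψ (Additive.ofMul (a : E)) = χ (Additive.ofMul a) := by
  obtain ⟨b, hb⟩ := exists_eq_of_transgression_eq_zero q (ContinuousMonoidHom.id B) s hs hA χ h0
  -- the `A`-component of `e = a · s(q e)`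
  let π : E → extKer q := fun e => ⟨e * (s (q e))⁻¹, mul_section_inv_mem_extKer q s hs e⟩
  have hπc : Continuous π :=
    Continuous.subtype_mk (continuous_id.mul ((s.continuous.comp q.continuous).inv)) _
  -- multiplicativity of the decomposition, using centrality
  have hπmul : ∀ e₁ e₂ : E, π (e₁ * e₂) = π e₁ * π e₂ * factorSet q (ContinuousMonoidHom.id B) s hs
      (q e₁) (q e₂) := by
    intro e₁ e₂
    apply Subtype.ext
    change e₁ * e₂ * (s (q (e₁ * e₂)))⁻¹ =
      e₁ * (s (q e₁))⁻¹ * (e₂ * (s (q e₂))⁻¹) * (s (q e₁) * s (q e₂) * (s (q e₁ * q e₂))⁻¹)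
    have hc : s (q e₁) * (e₂ * (s (q e₂))⁻¹) = e₂ * (s (q e₂))⁻¹ * s (q e₁) :=
      hA _ (mul_section_inv_mem_extKer q s hs e₂) (s (q e₁))
    rw [map_mul]
    calc e₁ * e₂ * (s (q e₁ * q e₂))⁻¹
        = e₁ * ((s (q e₁))⁻¹ * (s (q e₁) * (e₂ * (s (q e₂))⁻¹)) * s (q e₂)) * (s (q e₁ * q e₂))⁻¹ := by
          simp only [mul_assoc, inv_mul_cancel_left, inv_mul_cancel, mul_one]
      _ = e₁ * ((s (q e₁))⁻¹ * (e₂ * (s (q e₂))⁻¹ * s (q e₁)) * s (q e₂)) * (s (q e₁ * q e₂))⁻¹ := by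
          rw [hc]
      _ = e₁ * (s (q e₁))⁻¹ * (e₂ * (s (q e₂))⁻¹) * (s (q e₁) * s (q e₂) * (s (q e₁ * q e₂))⁻¹) := by
          simp only [mul_assoc]
  refine ⟨{ toFun := fun e => χ (Additive.ofMul (π (Additive.toMul e))) + b (q (Additive.toMul e))
            map_zero' := ?_
            map_add' := fun e₁ e₂ => ?_
            continuous_toFun := ?_ }, fun a => ?_⟩
  · -- `ψ 0 = 0`: `π 1 = c_s(1,1)⁻¹ · …`; easiest from additivity-type computation at `1`
    change χ (Additive.ofMul (π 1)) + b (q 1) = 0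
    have h11 := hb 1 1
    rw [mul_one] at h11
    have hπ1 : π 1 = (factorSet q (ContinuousMonoidHom.id B) s hs 1 1)⁻¹ := by
      apply Subtype.ext
      change (1 : E) * (s (q 1))⁻¹ = (s 1 * s 1 * (s (1 * 1))⁻¹)⁻¹
      rw [map_one, mul_one, mul_inv_cancel_right, one_mul]
    rw [hπ1, ofMul_inv, map_neg, map_one, h11]
    abel
  · change χ (Additive.ofMul (π (Additive.toMul e₁ * Additive.toMul e₂))) +
        b (q (Additive.toMul e₁ * Additive.toMul e₂)) =
      χ (Additive.ofMul (π (Additive.toMul e₁))) + b (q (Additive.toMul e₁)) +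
        (χ (Additive.ofMul (π (Additive.toMul e₂))) + b (q (Additive.toMul e₂)))
    rw [hπmul, map_mul q, ofMul_mul, ofMul_mul, map_add χ, map_add χ, hb]
    abel
  · exact (χ.continuous.comp (continuous_ofMul.comp (hπc.comp continuous_toMul))).add
      (b.continuous.comp (q.continuous.comp continuous_toMul))
  · change χ (Additive.ofMul (π (a : E))) + b (q (a : E)) = χ (Additive.ofMul a)
    have ha : q (a : E) = 1 := a.2
    have hπa : π (a : E) = a * (factorSet q (ContinuousMonoidHom.id B) s hs 1 1)⁻¹ := by
      apply Subtype.ext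
      change (a : E) * (s (q (a : E)))⁻¹ = a * (s 1 * s 1 * (s (1 * 1))⁻¹)⁻¹
      rw [ha, mul_one, mul_inv_cancel_right]
    have h11 := hb 1 1
    rw [mul_one] at h11
    rw [hπa, ofMul_mul, ofMul_inv, map_add, map_neg, h11, ha]
    abel

/-- **Exactness of the five-term sequence at `Hom(A, Λ)`** (section case): `transgression χ = 0` iff
`χ` is the restriction to `A` of a continuous homomorphism `Ẽ → Λ`.
[cite: SerreGaloisCohomology1997, I §2.6 (b)] -/
theorem transgression_eq_zero_iff_exists_extension (hA : ∀ a ∈ extKer q, ∀ e : E, e * a = a * e)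
    (χ : Additive (extKer q) →ₜ+ Λ) :
    transgression q (ContinuousMonoidHom.id B) s hs hA χ = 0 ↔
      ∃ ψ : Additive E →ₜ+ Λ, ∀ a : extKer q, ψ (Additive.ofMul (a : E)) = χ (Additive.ofMul a) :=
  ⟨exists_extension_of_transgression_eq_zero q s hs hA χ,
    fun ⟨ψ, hψ⟩ => transgression_eq_zero_of_extension q s hs hA χ ψ hψ⟩

/-- **The transgression is injective iff every continuous homomorphism `Ẽ → Λ` kills `A`.**
[cite: SerreGaloisCohomology1997, I §2.6 (b)] -/
theorem transgression_injective_iff (hA : ∀ a ∈ extKer q, ∀ e : E, e * a = a * e) :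
    Function.Injective (transgression q (ContinuousMonoidHom.id B) s hs hA (Λ := Λ)) ↔
      ∀ ψ : Additive E →ₜ+ Λ, ∀ a : extKer q, ψ (Additive.ofMul (a : E)) = 0 := by
  constructor
  · intro hinj ψ a
    -- the restriction of `ψ` to `A` has transgression `0`, hence is `0`
    let χ : Additive (extKer q) →ₜ+ Λ :=
      { toFun := fun x => ψ (Additive.ofMul ((Additive.toMul x : extKer q) : E))
        map_zero' := by
          change ψ (Additive.ofMul ((1 : extKer q) : E)) = 0
          rw [OneMemClass.coe_one, ofMul_one, map_zero]
        map_add' := fun x y => by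
          change ψ (Additive.ofMul ((Additive.toMul x * Additive.toMul y : extKer q) : E)) = _
          rw [Subgroup.coe_mul, ofMul_mul, map_add]
        continuous_toFun :=
          ψ.continuous.comp (continuous_ofMul.comp (continuous_subtype_val.comp continuous_toMul)) }
    have hχ : transgression q (ContinuousMonoidHom.id B) s hs hA χ = 0 :=
      transgression_eq_zero_of_extension q s hs hA χ ψ fun _ => rfl
    have hχ0 : χ = 0 := hinj (hχ.trans (map_zero _).symm)
    exact (congrArg (fun f : Additive (extKer q) →ₜ+ Λ => f (Additive.ofMul a)) hχ0 :)
  · intro hkill χ χ' hχχ'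
    have h0 : transgression q (ContinuousMonoidHom.id B) s hs hA (χ - χ') = 0 := by
      rw [map_sub, hχχ', sub_self]
    obtain ⟨ψ, hψ⟩ := exists_extension_of_transgression_eq_zero q s hs hA (χ - χ') h0
    apply ContinuousAddMonoidHom.ext
    intro x
    have hx := hψ (Additive.toMul x)
    rw [hkill ψ] at hx
    change (0 : Λ) = χ x - χ' x at hx
    exact (sub_eq_zero.mp hx.symm)

/-- **Sufficient condition for injectivity**: if `A = Ker q` lies in the closure of the commutator
subgroup of `Ẽ` and `Λ` is `T₁`, the transgression `Hom_cont(A, Λ) → H²(B, Λ)` is injective (a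
continuous homomorphism to the abelian `T₁` group `Λ` kills commutators, hence their closure).
[cite: SerreGaloisCohomology1997, I §2.6 (b)] -/
theorem transgression_injective_of_extKer_le [T1Space Λ]
    (hA : ∀ a ∈ extKer q, ∀ e : E, e * a = a * e)
    (hle : extKer q ≤ (commutator E).topologicalClosure) :
    Function.Injective (transgression q (ContinuousMonoidHom.id B) s hs hA (Λ := Λ)) := by
  rw [transgression_injective_iff]
  intro ψ a
  -- the kernel of `ψ ∘ ofMul` is a closed subgroup containing all commutators
  let K : Subgroup E :=
    { carrier := {e | ψ (Additive.ofMul e) = 0}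
      one_mem' := by
        change ψ (Additive.ofMul 1) = 0
        rw [ofMul_one, map_zero]
      mul_mem' := fun {x y} hx hy => by
        change ψ (Additive.ofMul (x * y)) = 0
        rw [ofMul_mul, map_add, hx, hy, add_zero]
      inv_mem' := fun {x} hx => by
        change ψ (Additive.ofMul x⁻¹) = 0
        rw [ofMul_inv, map_neg, hx, neg_zero] }
  have hKc : IsClosed (K : Set E) :=
    isClosed_singleton.preimage (ψ.continuous.comp continuous_ofMul)
  have hcomm : commutator E ≤ K := by
    rw [commutator_def, Subgroup.commutator_le]
    intro x _ y _
    change ψ (Additive.ofMul (x * y * x⁻¹ * y⁻¹)) = 0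
    rw [ofMul_mul, ofMul_mul, ofMul_mul, ofMul_inv, ofMul_inv, map_add, map_add, map_add, map_neg,
      map_neg]
    abel
  have hK : (commutator E).topologicalClosure ≤ K := Subgroup.topologicalClosure_minimal _ hcomm hKc
  exact hK (hle a.2)

end Section

end ContinuousCohomology
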